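import Summits.CriticalPhenomena.PercolationContinuityZ3.Theorems.PercNearOneGluingNoHeavyLowerTailSunflowerLawOneStep
import Summits.CriticalPhenomena.PercolationContinuityZ3.Theorems.PercNearOneGluingNoHeavyLowerTailSunflowerLawPolarizedC1

/-!
# `NoHeavyLowerTail` (crux stmt-CriticalPhenomena-4575), abstract sunflower cubic at LAW level: the PENCIL SPLIT — gen 28's one-step
# coefficients `triH m₁ m₀ m₀`, `triH m₁ m₁ m₀` are `2(λ_B + α) = 2(λ_A + β)` with the Gladkov parts `α, β ≥ 0` (`…LawPencilForms`),
# so `LawMixedNonneg` — hence H-COMB for all product measures — follows from the POLARIZED (C1) dichotomy `LawPolarizedC1`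

Support file (seat `prim-ineq-gen-2` gen 29; `--supports stmt-CriticalPhenomena-4575`).  Nothing is asserted about the crux; no `sorry`, no named
facts, no new definitions, standard axioms.  Memo: run/shared/lean/prim/prim-ineq-gen-2/SHARP-FORM-GEN29.md §6.

* `triH_mixed_eq_mixedH` — gen 28's mixed value is the polynomial `LawPencil.mixedH` of `…LawPencilForms`; `cellVec_eq_cells` — the two cell
  vectors agree (`rfl`).
* `LawPolarizedC1` is the typed CONJECTURE of `…SunflowerLawPolarizedC1` ("(C1-law) Bernstein-coefficientwise along one coordinate"):
  with `m₀ = cells (p[e↦0])`, `m₁ = cells (p[e↦1])`, `mixedLA m₁ m₀ ≥ 0 ∨ mixedLB m₁ m₀ ≥ 0` and the mirror; there it is shown to give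
  `mixedH m₁ m₀ ≥ 0 ∧ mixedH m₀ m₁ ≥ 0` (`mixedH_sections_nonneg_of_lawPolarizedC1`).
* **`lawMixedNonneg_of_polarizedC1 : LawPolarizedC1 → LawMixedNonneg`** and **`lawH_nonneg_of_polarizedC1`**: the polarized dichotomy implies
  gen 28's one-step inequalities, hence `(a + b)(ab − e₂(c)) ≥ e₃(c)` for every three-petal sunflower of up-sets of a finite cube and every
  product measure (`LawOneStep.lawH_nonneg_of_mixedNonneg`).
-/

noncomputable section

namespace Summit.CriticalPhenomena.PercolationContinuityZ3.Theorems.SunflowerPartition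

namespace LawPencil

open MeasureTheory LawOneStep
open Literature.Probability.LatticeModels Literature.Probability.Percolation

variable {ι : Type*}

/-- gen 28's mixed trilinear value is the explicit polynomial `mixedH`. [this work] -/
theorem triH_mixed_eq_mixedH (u m : Fin 5 → ℝ) : triH u m m = mixedH u m := by
  rw [triH_mixed_eq]
  simp only [mixedH]

/-- The two cell vectors agree. [this work] -/
theorem cellVec_eq_cells (q : ι → unitInterval) (E₁ E₂ E₃ A : Set (Set ι)) : cellVec q E₁ E₂ E₃ A = cells q E₁ E₂ E₃ A := rfl

/-- `triH u u m = triH m u u`: the trilinear form of the symmetric kernel `s6H` is symmetric (turns the second mixed coefficient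
`triH m₁ m₁ m₀` into first-position form `triH m₀ m₁ m₁`). [this work] -/
theorem triH_swap (u m : Fin 5 → ℝ) : triH u u m = triH m u u := by
  simp only [triH, s6Hr, s6H_table, Fin.sum_univ_five]
  simp only [Matrix.cons_val_zero, Matrix.cons_val_one, Matrix.cons_val]
  norm_num
  ring

/-- **REDUCTION 1**: the polarized (C1) dichotomy implies gen 28's one-step inequalities `LawMixedNonneg`. [this work] -/
theorem lawMixedNonneg_of_polarizedC1 (h : LawPolarizedC1) : LawMixedNonneg := by
  intro ι _ _ p E₁ E₂ E₃ A h₁ h₂ h₃ h12 h13 h23 e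
  obtain ⟨hk1, hk2⟩ := mixedH_sections_nonneg_of_lawPolarizedC1 h p h₁ h₂ h₃ h12 h13 h23 e
  simp only [cellVec_eq_cells]
  refine ⟨?_, ?_⟩
  · rw [triH_mixed_eq_mixedH]
    exact hk1
  · rw [triH_swap, triH_mixed_eq_mixedH]
    exact hk2

/-- **REDUCTION 2**: the polarized (C1) dichotomy implies H-COMB `(a + b)(ab − e₂(c)) ≥ e₃(c)` for every three-petal sunflower of up-sets of
a finite cube and every product measure (through gen 28's `LawOneStep.lawH_nonneg_of_mixedNonneg`). [this work] -/
theorem lawH_nonneg_of_polarizedC1 (h : LawPolarizedC1) {ι : Type} [Fintype ι] [DecidableEq ι]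
    (p : ι → unitInterval) {A E₁ E₂ E₃ : Set (Set ι)}
    (h₁ : IsUpperSet E₁) (h₂ : IsUpperSet E₂) (h₃ : IsUpperSet E₃)
    (h12 : E₁ ∩ E₂ = A) (h13 : E₁ ∩ E₃ = A) (h23 : E₂ ∩ E₃ = A) :
    0 ≤ ((prodBernoulli p).real A + (prodBernoulli p).real (E₁ ∪ E₂ ∪ E₃)ᶜ) *
        ((prodBernoulli p).real A * (prodBernoulli p).real (E₁ ∪ E₂ ∪ E₃)ᶜ -
          ((prodBernoulli p).real (E₁ \ A) * (prodBernoulli p).real (E₂ \ A) +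
            (prodBernoulli p).real (E₁ \ A) * (prodBernoulli p).real (E₃ \ A) +
            (prodBernoulli p).real (E₂ \ A) * (prodBernoulli p).real (E₃ \ A))) -
      (prodBernoulli p).real (E₁ \ A) * (prodBernoulli p).real (E₂ \ A) * (prodBernoulli p).real (E₃ \ A) :=
  lawH_nonneg_of_mixedNonneg (lawMixedNonneg_of_polarizedC1 h) p h₁ h₂ h₃ h12 h13 h23

end LawPencil

end Summit.CriticalPhenomena.PercolationContinuityZ3.Theorems.SunflowerPartition

end
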